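import Literature.NumberTheory.QuadraticFields.ThreeTorsionProofs
import Literature.NumberTheory.QuadraticFields.UnitsModCubes
import Mathlib.NumberTheory.NumberField.ClassNumber
import Mathlib.RingTheory.RootsOfUnity.PrimitiveRoots
import HarnessLib

/-!
# Arithmetic bookkeeping for Scholz's reflection theorem: the mirror discriminant, the three small
# fields `ℚ(√-3), ℚ(i), ℚ(√3)`, and transport along isomorphisms

Topic `NumberTheory/QuadraticFields`.  Theorem-only file (no definition, no named fact).

Elementary facts used to pass from the Kummer-theoretic inequality
`#Cl(K)[3] ≤ #(U_k/U_k³) · #Cl(k)[3]` (`K = ℚ(√d)`, `k = ℚ(√-3d)`,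
`ScholzReflectionCount.lean`) to the printed form of Scholz's theorem for the pair
`(ℚ(√3d), ℚ(√-d))` in `3`-torsion counts (`Literature.NumberTheory.QuadraticFields.Scholz1932_reflection`):

* `isFundamental_mirrorDisc` — for `-d` a negative fundamental discriminant, `d ≠ 3`, the number
  `D⁺ = d/3` (`3 ∣ d`) resp. `3d` (`3 ∤ d`) is a fundamental discriminant (that of `ℚ(√3d)`);
* `quadFieldThreeTorsion_eq_one_of_discr` — `#Cl₃(D) = 1` for `D ∈ {-4, -3, 12}`: by Minkowski's
  bound (Mathlib `RingOfIntegers.isPrincipalIdealRing_of_abs_discr_lt`: `|D| < 16 (π/4)^{2r₂}`) the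
  fields `ℚ(i), ℚ(√-3), ℚ(√3)` have class number one; and `quadFieldThreeTorsion 1 = 1` (junk);
* `not_mem_range_algebraMap_of_isPrimitiveRoot` — a quadratic field of discriminant `≠ -3` contains
  no primitive cube root of unity (`ℚ(ζ₃) = ℚ(√-3)` has discriminant `-3`,
  `eq_of_isFundamental_of_eq_mul_sq`);
* `natCard_threeTorsion_congr'`, `nonempty_mulEquiv_unitsModCubes` — `#Cl[3]` and `U/U³` are
  invariant under field isomorphisms.

## References

* L. C. Washington, *Introduction to Cyclotomic Fields*, GTM 83, 2nd ed. (1997), Thm. 10.10.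
  [Washington1997]
* D. A. Marcus, *Number Fields*, 2nd ed. (2018), Ch. 5, Cor. 2 of Thm. 37 (Minkowski bound).
  [Marcus2018]
-/

noncomputable section

open Module NumberField NumberField.InfinitePlace

namespace Literature.NumberTheory.QuadraticFields

open Quadratic

/-! ### The mirror discriminant `D⁺` is fundamental -/

/-- `-n` is squarefree in `ℤ` iff `n` is squarefree in `ℕ`. [folklore] -/
theorem squarefree_neg_natCast_iff (n : ℕ) : Squarefree (-(n : ℤ)) ↔ Squarefree n := by
  rw [← Int.squarefree_natAbs, Int.natAbs_neg, Int.natAbs_natCast]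

/-- **The discriminant of `ℚ(√3d)`**: if `-d` is a (negative) fundamental discriminant and `d ≠ 3`,
then `D⁺ := d/3` (if `3 ∣ d`) resp. `3d` (if `3 ∤ d`) is again a fundamental discriminant (the four
residue cases `d ≡ 3 (4)` / `d = 4e` times `3 ∣ d` / `3 ∤ d`). [folklore] -/
theorem isFundamental_mirrorDisc {d : ℕ}
    (hd : ((-(d : ℤ)) % 4 = 1 ∧ Squarefree (-(d : ℤ)) ∧ (-(d : ℤ)) ≠ 1) ∨
      (4 ∣ (-(d : ℤ)) ∧ ((-(d : ℤ)) / 4 % 4 = 2 ∨ (-(d : ℤ)) / 4 % 4 = 3) ∧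
        Squarefree ((-(d : ℤ)) / 4)))
    (hd3 : d ≠ 3) :
    ((if 3 ∣ d then ((d / 3 : ℕ) : ℤ) else 3 * (d : ℤ)) % 4 = 1 ∧
        Squarefree (if 3 ∣ d then ((d / 3 : ℕ) : ℤ) else 3 * (d : ℤ)) ∧
        (if 3 ∣ d then ((d / 3 : ℕ) : ℤ) else 3 * (d : ℤ)) ≠ 1) ∨
      (4 ∣ (if 3 ∣ d then ((d / 3 : ℕ) : ℤ) else 3 * (d : ℤ)) ∧
        ((if 3 ∣ d then ((d / 3 : ℕ) : ℤ) else 3 * (d : ℤ)) / 4 % 4 = 2 ∨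
          (if 3 ∣ d then ((d / 3 : ℕ) : ℤ) else 3 * (d : ℤ)) / 4 % 4 = 3) ∧
        Squarefree ((if 3 ∣ d then ((d / 3 : ℕ) : ℤ) else 3 * (d : ℤ)) / 4)) := by
  have hsq3 : Squarefree (3 : ℕ) := Nat.prime_three.prime.squarefree
  by_cases h3 : 3 ∣ d
  · rw [if_pos h3]
    obtain ⟨e, rfl⟩ := h3
    rw [Nat.mul_div_cancel_left e (by norm_num : 0 < 3)]
    have he3 : e ≠ 1 := fun h => hd3 (by rw [h])
    rcases hd with ⟨h1, hsq, -⟩ | ⟨h4, hres, hsq⟩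
    · left
      refine ⟨by push_cast at h1 ⊢; omega, ?_, by exact_mod_cast he3⟩
      rw [squarefree_neg_natCast_iff] at hsq
      exact Int.squarefree_natCast.mpr (hsq.squarefree_of_dvd ⟨3, by ring⟩)
    · right
      obtain ⟨f, rfl⟩ : ∃ f, e = 4 * f := ⟨e / 4, by push_cast at h4; omega⟩
      have hq : (-((3 * (4 * f) : ℕ) : ℤ)) / 4 = -((3 * f : ℕ) : ℤ) := by push_cast; omega
      rw [hq, squarefree_neg_natCast_iff] at hsq
      rw [hq] at hres
      refine ⟨⟨f, by push_cast; ring⟩, ?_, ?_⟩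
      · push_cast at hres ⊢
        omega
      · have hq' : ((4 * f : ℕ) : ℤ) / 4 = ((f : ℕ) : ℤ) := by push_cast; omega
        rw [hq', Int.squarefree_natCast]
        exact hsq.squarefree_of_dvd ⟨3, by ring⟩
  · rw [if_neg h3]
    have hcop : Nat.Coprime 3 d := (Nat.Prime.coprime_iff_not_dvd Nat.prime_three).mpr h3
    rcases hd with ⟨h1, hsq, -⟩ | ⟨h4, hres, hsq⟩
    · left
      refine ⟨by omega, ?_, by omega⟩
      rw [squarefree_neg_natCast_iff] at hsq
      have h := (Nat.squarefree_mul hcop).mpr ⟨hsq3, hsq⟩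
      exact_mod_cast Int.squarefree_natCast.mpr h
    · right
      obtain ⟨e, rfl⟩ : ∃ e, d = 4 * e := ⟨d / 4, by omega⟩
      have hq : (-((4 * e : ℕ) : ℤ)) / 4 = -((e : ℕ) : ℤ) := by push_cast; omega
      rw [hq, squarefree_neg_natCast_iff] at hsq
      rw [hq] at hres
      have hcop' : Nat.Coprime 3 e :=
        (Nat.Prime.coprime_iff_not_dvd Nat.prime_three).mpr fun h => h3 (h.mul_left 4)
      refine ⟨⟨3 * e, by push_cast; ring⟩, ?_, ?_⟩
      · push_cast at hres ⊢
        omega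
      · have hq' : (3 * ((4 * e : ℕ) : ℤ)) / 4 = ((3 * e : ℕ) : ℤ) := by push_cast; omega
        rw [hq']
        exact Int.squarefree_natCast.mpr ((Nat.squarefree_mul hcop').mpr ⟨hsq3, hsq⟩)

/-! ### Small discriminants: `ℚ(i)`, `ℚ(√-3)`, `ℚ(√3)` have class number one -/

section Small

variable {K : Type*} [Field K] [NumberField K]

/-- For a quadratic field, `d_K > 0` forces `r₂ = 0` and `d_K < 0` forces `r₂ = 1`
(`sign d_K = (-1)^{r₂}`, `r₁ + 2r₂ = 2`). [folklore] -/
theorem nrComplexPlaces_eq_ite (h2 : finrank ℚ K = 2) :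
    nrComplexPlaces K = if 0 < NumberField.discr K then 0 else 1 := by
  have hsign := NumberField.sign_discr K
  have hrk := card_add_two_mul_card_eq_rank K
  rw [h2] at hrk
  have hle : nrComplexPlaces K ≤ 1 := by omega
  have hD0 : NumberField.discr K ≠ 0 := NumberField.discr_ne_zero K
  split_ifs with hpos
  · rw [Int.sign_eq_one_of_pos hpos] at hsign
    rcases Nat.even_or_odd (nrComplexPlaces K) with ⟨m, hm⟩ | ⟨m, hm⟩
    · omega
    · rw [hm, pow_add, pow_mul] at hsign
      norm_num at hsign
  · have hneg : NumberField.discr K < 0 := lt_of_le_of_ne (not_lt.mp hpos) hD0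
    rw [Int.sign_eq_neg_one_of_neg hneg] at hsign
    rcases Nat.even_or_odd (nrComplexPlaces K) with ⟨m, hm⟩ | ⟨m, hm⟩
    · rw [hm, ← two_mul, pow_mul] at hsign
      norm_num at hsign
    · omega

/-- **Minkowski**: a quadratic field with `d_K ∈ {-4, -3, 12}` has class number one
(`|d_K| < 16 (π/4)^{2 r₂}`, i.e. `< 16` resp. `< π²`). [cite: Marcus2018, Ch. 5, Cor. 2 of Thm. 37] -/
theorem isPrincipalIdealRing_of_discr (h2 : finrank ℚ K = 2)
    (hD : NumberField.discr K = -4 ∨ NumberField.discr K = -3 ∨ NumberField.discr K = 12) :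
    IsPrincipalIdealRing (𝓞 K) := by
  have hr := nrComplexPlaces_eq_ite h2
  apply RingOfIntegers.isPrincipalIdealRing_of_abs_discr_lt
  rw [hr, h2]
  have hπ := Real.pi_gt_three
  rcases hD with h | h | h <;> rw [h] <;> norm_num [Nat.factorial] <;> nlinarith

/-- A principal ring of integers has `#Cl[3] = 1`. [folklore] -/
theorem natCard_threeTorsion_eq_one_of_isPrincipalIdealRing (h : IsPrincipalIdealRing (𝓞 K)) :
    Nat.card {c : ClassGroup (𝓞 K) // c ^ 3 = 1} = 1 := by
  classical
  haveI : Subsingleton (ClassGroup (𝓞 K)) :=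
    Fintype.card_le_one_iff_subsingleton.mp (card_classGroup_eq_one_iff.mpr h).le
  exact Nat.card_eq_one_iff_unique.mpr ⟨inferInstance, ⟨⟨1, one_pow 3⟩⟩⟩

end Small

/-- **`#Cl₃(D) = 1` for `D ∈ {-4, -3, 12}`** (class number one of `ℚ(i), ℚ(√-3), ℚ(√3)`).
[cite: Marcus2018, Ch. 5, Cor. 2 of Thm. 37] -/
theorem quadFieldThreeTorsion_eq_one_of_mem {D : ℤ} (hD : D = -4 ∨ D = -3 ∨ D = 12) :
    quadFieldThreeTorsion D = 1 := by
  have hfund : (D % 4 = 1 ∧ Squarefree D ∧ D ≠ 1) ∨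
      (4 ∣ D ∧ (D / 4 % 4 = 2 ∨ D / 4 % 4 = 3) ∧ Squarefree (D / 4)) := by
    have hsq3 : Squarefree (3 : ℤ) := by
      simpa using Int.squarefree_natCast.mpr Nat.prime_three.prime.squarefree
    have hsq3' : Squarefree (-3 : ℤ) := by
      simpa using (squarefree_neg_natCast_iff 3).mpr Nat.prime_three.prime.squarefree
    rcases hD with rfl | rfl | rfl
    · right
      exact ⟨⟨-1, by norm_num⟩, Or.inr (by decide), by norm_num⟩
    · left
      exact ⟨by decide, hsq3', by norm_num⟩
    · right
      refine ⟨⟨3, by norm_num⟩, Or.inr (by decide), ?_⟩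
      norm_num
  obtain ⟨K, _, _, h2, hK⟩ := exists_numberField_discr_eq hfund
  rw [quadFieldThreeTorsion_eq D K h2 hK]
  apply natCard_threeTorsion_eq_one_of_isPrincipalIdealRing
  apply isPrincipalIdealRing_of_discr h2
  rw [hK]
  exact hD

/-- `quadFieldThreeTorsion 1 = 1` (`1` is not a fundamental discriminant). [folklore] -/
theorem quadFieldThreeTorsion_one : quadFieldThreeTorsion 1 = 1 :=
  quadFieldThreeTorsion_of_not_isFundamental (by
    rintro (⟨-, -, h⟩ | ⟨h4, -, -⟩)
    · exact h rfl
    · norm_num at h4)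

/-! ### No cube roots of unity in a quadratic field of discriminant `≠ -3` -/

/-- **A quadratic field of discriminant `≠ -3` contains no primitive cube root of unity**: such a
root `x` gives `θ = 2x + 1` with `θ² = -3`, `θ ∉ ℚ`, so `d_K = -3 q²` and `d_K = -3` by uniqueness
of the fundamental discriminant in a square class. [folklore] -/
theorem not_mem_range_algebraMap_of_isPrimitiveRoot {K : Type*} [Field K] [NumberField K]
    (h2 : finrank ℚ K = 2) (hD : NumberField.discr K ≠ -3) {L : Type*} [Field L] [Algebra K L]
    {ζ : L} (hζ : IsPrimitiveRoot ζ 3) : ζ ∉ Set.range (algebraMap K L) := by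
  rintro ⟨x, hx⟩
  rw [← hx] at hζ
  have hx3 : IsPrimitiveRoot x 3 := hζ.of_map_of_injective (algebraMap K L).injective
  -- `x² + x + 1 = 0`, so `θ = 2x + 1` has `θ² = -3`
  have hsum := hx3.geom_sum_eq_zero (by norm_num : 1 < 3)
  simp only [Finset.sum_range_succ, Finset.sum_range_zero, pow_zero, pow_one, zero_add] at hsum
  have hθ2 : (2 * x + 1) ^ 2 = algebraMap ℚ K (-3) := by
    rw [map_neg, map_ofNat]
    linear_combination (4 : K) * hsum
  have hθ : (2 * x + 1) ∉ Set.range (algebraMap ℚ K) := by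
    rintro ⟨q, hq⟩
    have h : algebraMap ℚ K (q ^ 2) = algebraMap ℚ K (-3) := by rw [map_pow, hq, hθ2]
    have hq2 : q ^ 2 = -3 := (algebraMap ℚ K).injective h
    nlinarith [sq_nonneg q]
  obtain ⟨q, -, hq⟩ := NumberField.exists_discr_eq_mul_sq h2 hθ hθ2
  have h3fund : ((-3 : ℤ) % 4 = 1 ∧ Squarefree (-3 : ℤ) ∧ (-3 : ℤ) ≠ 1) ∨
      (4 ∣ (-3 : ℤ) ∧ ((-3 : ℤ) / 4 % 4 = 2 ∨ (-3 : ℤ) / 4 % 4 = 3) ∧ Squarefree ((-3 : ℤ) / 4)) :=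
    Or.inl ⟨by decide, by simpa using (squarefree_neg_natCast_iff 3).mpr Nat.prime_three.prime.squarefree,
      by norm_num⟩
  exact hD (eq_of_isFundamental_of_eq_mul_sq (isFundamentalDiscriminant_discr h2) h3fund
    (q := q) (by rw [hq]; push_cast; ring))

/-! ### Transport along field isomorphisms -/

/-- `#Cl[3]` is invariant under field isomorphisms. [folklore] -/
theorem natCard_threeTorsion_congr' {k K' : Type*} [Field k] [NumberField k] [Field K']
    [NumberField K'] (e : k ≃+* K') :
    Nat.card {c : ClassGroup (𝓞 k) // c ^ 3 = 1} = Nat.card {c : ClassGroup (𝓞 K') // c ^ 3 = 1} :=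
  natCard_pow_eq_one_congr (ClassGroup.mulEquiv (RingOfIntegers.mapRingEquiv e)) 3

/-- **`U/U³` is invariant under field isomorphisms.** [folklore] -/
theorem nonempty_mulEquiv_unitsModCubes {k K' : Type*} [Field k] [Field K'] (e : k ≃+* K') :
    Nonempty ((𝓞 k)ˣ ⧸ unitCubes k ≃* (𝓞 K')ˣ ⧸ unitCubes K') := by
  let f : (𝓞 k)ˣ ≃* (𝓞 K')ˣ := Units.mapEquiv (RingOfIntegers.mapRingEquiv e).toMulEquiv
  refine ⟨QuotientGroup.congr (unitCubes k) (unitCubes K') f ?_⟩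
  ext y
  simp only [Subgroup.mem_map, MonoidHom.mem_range, powMonoidHom_apply, MonoidHom.coe_coe]
  constructor
  · rintro ⟨x, ⟨z, rfl⟩, rfl⟩
    exact ⟨f z, by rw [map_pow]⟩
  · rintro ⟨z, rfl⟩
    exact ⟨(f.symm z) ^ 3, ⟨f.symm z, rfl⟩, by rw [map_pow, MulEquiv.apply_symm_apply]⟩

end Literature.NumberTheory.QuadraticFields

end
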